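import Mathlib
import Summits.Ventures.PercRepro.TriangleCapW29Refutation

/-!
# PercRepro — `W29` refutes the closed form itself and the three dead cocircuit forms (p3, gen 27)

CONJECTURE 10b of the triangle-cap lane (P3-TRIANGLE-CAP.md §10b) is the closed form
`T(M) ≤ P_KK(ν)` for every finite `Core3` matroid of nullity `ν`.  On `W29` (TriangleCapW29Matroid /
TriangleCapW29Refutation) the kernel now knows `Core3 M`, `|E| = r(M) + 23` and the `60` triangles, and
`P_KK(23) = 59`:

* `ncard_triangles_eq : (ThmN.triangles M).ncard = 60`;
* **`not_closedForm`** — the closed form is FALSE on `Fin 29` (the first kernel witness against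
  CONJECTURE 10b; mine-4 g27's W31 / W29, RULING (um)(96));
* `not_existsGoodCocircuit`, `not_minCocircuitDeltaBound`, `not_minCocircuitGainBound` — the three
  stronger cocircuit forms (TriangleCapMatroidReduction / TriangleCapDeltaForm) are false on `Fin 29`
  too, through the tree's implications into `ExistsDeltaCocircuit`.

Axioms: standard.
-/

open scoped Matroid

namespace PercRepro

namespace TriangleCap

namespace W29

open Set Matroid

/-- `W29` has exactly `60` triangles. -/
theorem ncard_triangles_eq : (ThmN.triangles M).ncard = 60 := by
  rw [triangles_eq, ncard_image_of_injective _ Finset.coe_injective, ncard_coe_finset, tri_card]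

/-- `P_KK 23 = 59`. -/
theorem P_23 : KK.P 23 = 59 := by decide +kernel

/-- **CONJECTURE 10b is false on `Fin 29`**: `W29` is a finite `Core3` matroid with `|E| = r + 23` and
`60 > 59 = P_KK 23` triangles. -/
theorem not_closedForm :
    ¬ ∀ (N : Matroid (Fin 29)) [N.Finite], Cocirc.Core3 N →
      ∀ ν : ℕ, N.E.encard = N.eRank + ν → (ThmN.triangles N).ncard ≤ KK.P ν := by
  intro h
  haveI := M_finite
  have := h M core3 23 encard_eq
  rw [ncard_triangles_eq, P_23] at this
  omega

/-- The `min (C(|K|,2)) ν` existence form is false on `Fin 29`. -/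
theorem not_existsGoodCocircuit : ¬ Cocirc.ExistsGoodCocircuit (Fin 29) :=
  fun h => not_existsDeltaCocircuit (Cocirc.existsDeltaCocircuit_of_existsGoodCocircuit h)

/-- The Δ-form at every minimum cocircuit is false on `Fin 29`. -/
theorem not_minCocircuitDeltaBound : ¬ Cocirc.MinCocircuitDeltaBound (Fin 29) :=
  fun h => not_existsDeltaCocircuit (Cocirc.existsDeltaCocircuit_of_minCocircuitDeltaBound h)

/-- The minimum-cocircuit gain bound is false on `Fin 29`. -/
theorem not_minCocircuitGainBound : ¬ Cocirc.MinCocircuitGainBound (Fin 29) :=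
  fun h => not_existsGoodCocircuit (Cocirc.existsGoodCocircuit_of_minCocircuitGainBound h)

end W29

end TriangleCap

end PercRepro
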